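import Summits.Ventures.CertifiedManyBodySolver.Downfold.EmeryClusterCapSeam
import Summits.Ventures.CertifiedManyBodySolver.Downfold.EmeryBoxesLa214V123
import Literature.MathematicalPhysics.QuantumLattice.EmeryThreeBandThermalClusterVectorFloor
import HarnessLib

/-!
# THE THERMAL SEAM (`T > 0` twin of the 3BE cluster-floor / cap seam): typed Emery-box doors for the three-band pressure
# `emeryCellPressure β (emeryLine s q)` — CAP by the four lower-face corners, FLOOR from cluster Rayleigh traces in closed form, Lipschitz budget

Venture CertifiedManyBodySolver, cell `pub/hubbard-downfold` (S1 = ROUTER) × crew hubbard-fast S2 (iv) «multi-band × T > 0» (human ruling D-0096 (ii));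
seat hubbard-downfold-mod-4 (S1/S2 Emery seam). Namespace `Summit.Ventures.CertifiedManyBodySolver.Downfold`. hubbard-box-p1 g16 typed the `T > 0`
three-band row (`EmeryThreeBandThermalPressure` p632516: `emeryPressure β θ` / `emeryCellPressure β θ = 4P − 2 log 2` per CuO₂, jointly CONVEX and Lipschitz
in `θ ∈ ℝ¹⁴`, floor / cap / window from one cluster; `EmeryThreeBandThermalClusterVectorFloor` p633103: orthonormal cluster vectors with certified Rayleigh
quotients ⇒ `¼ log Σᵢ e^{−β eᵢ} ≤ emeryCellPressure β θ`). A router 3BE object is a typed `EmeryBox`; S2 reads its delivered six-box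
`q = (t_pd, t_pp, ε_d, ε_p, U_d, U_p) ∈ Set.Icc (emeryLo εp …) (emeryHi εp …)` along the physical line `θ = emeryLine s q` (`S2SeamEmery`). At `T > 0` the
reference level `εp` is NOT immaterial: `−εp` is the chemical potential (`EmeryReferenceLevel.emeryLine_emeryLineCoords_add`), so every door below keeps
`εp` free. THIS FILE (the `T = 0` seam read «concave ⇒ floors at the lower corners»; the pressure is a sup of affine functions, so everything flips):

* §1 LAWS ALONG THE LINE: `convexOn_emeryCellPressure_line` (convex in the six coordinates); `emeryPressure_anti_upper` / `emeryCellPressure_line_anti_tail`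
  — the pressure is NON-INCREASING in `(ε_d, ε_p, U_d, U_p)` for `β ≥ 0` (their conjugate densities are occupations / double occupancies ≥ 0,
  `EmeryMonotoneVertexFloors` §2 + box-p1's `perVarPressure_anti`); `abs_emeryPressure_sub_le_emeryConstants` / `abs_emeryCellPressure_line_sub_le` — the
  Lipschitz law with the class constants `(2,…,2,1,1,1)`: `|ΔP_cell| ≤ 4|β|·(8|Δt_pd| + 8|Δt_pp| + 2|Δε_d| + 4|Δε_p| + |ΔU_d| + 2|ΔU_p|)`.
* §2 THE CAP DOOR: `emeryCellPressure_line_le_of_lowerCorners` — caps `P_cell ≤ M` certified at the FOUR lower-face corners `lowerCorner lo hi i`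
  (`(t_pd, t_pp) ∈ {lo, hi}²`, `(ε_d, ε_p, U_d, U_p)` at their LOWER ends) bind the whole six-box (convexity on the lower face + anti-monotonicity);
  typed form **`holdsOn_emeryCellPressureCap_of_cornerCaps`** (any Emery box with the five seam entries, any `εp`, any `s`). A corner cap is what
  `emeryCellPressure_le_log_partitionFn_boost` certifies from an upper bound on a boosted `Cu_{k²}O_{2k²}` log-partition function.
* §3 THE FLOOR DOOR IN CLOSED FORM: `rayleigh_block_re_eq_sum` (a cluster vector's Rayleigh quotient at `θ` is `Σ_a θ_a·Tₐ`, `Tₐ` its fourteen per-atom traces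
  — linear in `θ`); **`holdsOn_emeryCellPressureFloor_of_rayleighTraces`**: an orthonormal family `φᵢ` of `Cu₄O₈` cluster vectors with EXACT per-atom traces
  `T i a = Re⟨φᵢ, hubbardOpenBoxGP 1 12 (cu4o8Tau a) (cu4o8Ups a) (cu4o8Nu a) φᵢ⟩` gives, for `β ≥ 0`, on the WHOLE typed box
  `¼ log Σᵢ exp(−β · affineCapBound s (T i) lo hi) ≤ emeryCellPressure β (emeryLine s (emeryLineCoords εp p))` — NO vertex enumeration: each affine trace is
  maximised over the six-box by the closed form `affineCapBound` of `EmeryClusterCapSeam`.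
* §4 TRANSPORT: `abs_emeryCellPressure_sub_le_of_mem_emeryLineBox` (two box points differ by ≤ `4|β|·(8w(t_pd) + 8w(t_pp) + 2w(Δ) + w(U_dd) + 2w(U_pp))`)
  and `holdsOn_emeryCellPressureFloor_of_point` / `…Cap_of_point` (one certified point ± the budget ⇒ a box word).
* §5 La₂CuO₄ (#18, `emeryBoxLa214v123`): the corner sheet at reference level `εp` (`la214v123Corner εp`; at `εp = 0` it is `la214v122xCorner`), the three
  doors instantiated, and the budget `4·19.19·|β| = 76.76|β|` (useless at cuprate temperatures — `β ≈ 11.6/eV` at 1000 K — which is WHY box-wide `T > 0`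
  words go through §2/§3, not through transport; stated to make that visible).

Everything PROVED (0 sorry); definitions with bodies: `la214v123Corner`. HONEST SCOPE: doors and laws; no certificate, no number, no phase word; the objects
are SCREENING-GRADE boxes; the floor's quality is that of the trial family and degrades with the box width through `affineCapBound`; the cap side needs an
upper bound on a 12-site boosted cluster partition function (box-p1: «no device yet; crude Σ_s dim_s e^{−βq_s} from KCert sector floors on request»).
-/

noncomputable section

namespace Summit.Ventures.CertifiedManyBodySolver.Downfold

open NonemptyInterval Matrix Finset Literature.Probability.LatticeModels
open Literature.MathematicalPhysics.QuantumLattice Literature.Computation.Certificates ClusterLowerBound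
open scoped BigOperators ComplexOrder

/-! ## §1 Laws along the physical line -/

/-- **The cell pressure is CONVEX in the six physical coordinates** (joint convexity in `θ` ∘ the linear map `emeryLine s`, then `4·P − 2 log 2`).
[cite: Israel1979, Thm. I.3.4] -/
theorem convexOn_emeryCellPressure_line (β : ℝ) (s : Fin 4 → ℝ) :
    ConvexOn ℝ Set.univ fun q : Fin 6 → ℝ => emeryCellPressure β (emeryLine s q) := by
  have h1 : ConvexOn ℝ Set.univ fun q : Fin 6 → ℝ => emeryPressure β (emeryLine s q) :=
    (convexOn_emeryPressure_couplings β).comp_linearMap (emeryLine s)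
  have h2 : ConvexOn ℝ Set.univ fun q : Fin 6 → ℝ => (4 : ℝ) • emeryPressure β (emeryLine s q) := h1.smul (by norm_num)
  have h3 := h2.sub (concaveOn_const (2 * Real.log 2) convex_univ)
  refine ⟨convex_univ, fun x _ y _ a b ha hb hab => ?_⟩
  have h := h3.2 (Set.mem_univ x) (Set.mem_univ y) ha hb hab
  simp only [Pi.sub_apply, smul_eq_mul, emeryCellPressure] at h ⊢
  exact h

/-- **The pressure is NON-INCREASING in the site energies and repulsions** (`β ≥ 0`): `θ ≤ θ'` on directions `8…13`, `=` on `0…7` ⇒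
`emeryPressure β θ' ≤ emeryPressure β θ` (occupations and double occupancies are ≥ 0 in every state, so raising their couplings raises every state's
energy). [cite: Israel1979, Thm. I.3.4] -/
theorem emeryPressure_anti_upper {β : ℝ} (hβ : 0 ≤ β) {θ θ' : Fin 14 → ℝ} (hle : θ ≤ θ') (hhop : ∀ a : Fin 14, a.val < 8 → θ a = θ' a) :
    emeryPressure β θ' ≤ emeryPressure β θ := by
  rw [emeryPressure_eq_linearFamily, emeryPressure_eq_linearFamily]
  refine FermionInteraction.perVarPressure_anti β liebPeriods _ 1 _ 1 hβ fun ω _ => ?_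
  rw [InfVolFermionState.cellMeanEnergy_linearFamily_eq_add_sum_sub_mul (hubbardFermionInteraction 2 0 0) emeryAtoms θ' θ ω 1]
  have hsum : 0 ≤ ∑ a, (θ' a - θ a) * InfVolFermionState.cellMeanEnergy liebPeriods (emeryAtoms a) ω 1 := by
    refine Finset.sum_nonneg fun a _ => ?_
    by_cases h : θ a = θ' a
    · rw [h, sub_self, zero_mul]
    · have ha : 8 ≤ a.val := by
        by_contra h8
        exact h (hhop a (by omega))
      rw [← InfVolFermionState.cellEnergy_emeryDirections_eq_cellMeanEnergy]
      exact mul_nonneg (sub_nonneg.2 (hle a)) (cellEnergy_emeryDirections_nonneg_of_ge_8 ω ha)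
  linarith

/-- **Along the line: raising any of `(ε_d, ε_p, U_d, U_p)` LOWERS the cell pressure** (`β ≥ 0`). [cite: Israel1979, Thm. I.3.4] -/
theorem emeryCellPressure_line_anti_tail {β : ℝ} (hβ : 0 ≤ β) (s : Fin 4 → ℝ) {q q' : Fin 6 → ℝ} (hle : q ≤ q')
    (h0 : q 0 = q' 0) (h1 : q 1 = q' 1) :
    emeryCellPressure β (emeryLine s q') ≤ emeryCellPressure β (emeryLine s q) := by
  have h := emeryPressure_anti_upper hβ (θ := emeryLine s q) (θ' := emeryLine s q') (fun a => ?_) (fun a ha => ?_)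
  · rw [emeryCellPressure, emeryCellPressure]; linarith
  · fin_cases a <;> simp [emeryLine, h0, h1, hle 2, hle 3, hle 4, hle 5]
  · have : a = 0 ∨ a = 1 ∨ a = 2 ∨ a = 3 ∨ a = 4 ∨ a = 5 ∨ a = 6 ∨ a = 7 := by
      rcases a with ⟨v, hv⟩
      simp only [Fin.ext_iff]
      simp only at ha
      omega
    rcases this with rfl | rfl | rfl | rfl | rfl | rfl | rfl | rfl <;> simp [emeryLine, h0, h1]

/-- **Lipschitz law with the class constants**: `|P(β,θ) − P(β,θ')| ≤ |β|·Σ_a emeryConstants a·|θ_a − θ'_a|` (`emeryConstants = (2,…,2,1,1,1)`).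
[cite: Israel1979, Thm. I.3.4] -/
theorem abs_emeryPressure_sub_le_emeryConstants (β : ℝ) (θ θ' : Fin 14 → ℝ) :
    |emeryPressure β θ - emeryPressure β θ'| ≤ |β| * ∑ a, emeryConstants a * |θ a - θ' a| := by
  rw [emeryPressure_eq_linearFamily, emeryPressure_eq_linearFamily]
  refine FermionInteraction.abs_perVarPressure_sub_le β liebPeriods _ 1 _ 1 fun ω _ => ?_
  rw [InfVolFermionState.cellMeanEnergy_linearFamily_eq_add_sum_sub_mul (hubbardFermionInteraction 2 0 0) emeryAtoms θ θ' ω 1, add_sub_cancel_left]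
  refine (Finset.abs_sum_le_sum_abs _ _).trans (Finset.sum_le_sum fun a _ => ?_)
  rw [abs_mul, ← InfVolFermionState.cellEnergy_emeryDirections_eq_cellMeanEnergy, mul_comm]
  exact mul_le_mul_of_nonneg_right (abs_cellEnergy_emeryDirections_le ω a) (abs_nonneg _)

/-- **Lipschitz law along the physical line** (`|s_k| ≤ 1`):
`|P_cell(q) − P_cell(q')| ≤ 4|β|·(8|Δq₀| + 8|Δq₁| + 2|Δq₂| + 4|Δq₃| + |Δq₄| + 2|Δq₅|)`. [cite: Israel1979, Thm. I.3.4] -/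
theorem abs_emeryCellPressure_line_sub_le (β : ℝ) {s : Fin 4 → ℝ} (hs : ∀ k, |s k| ≤ 1) (q q' : Fin 6 → ℝ) :
    |emeryCellPressure β (emeryLine s q) - emeryCellPressure β (emeryLine s q')| ≤
      4 * |β| * (8 * |q 0 - q' 0| + 8 * |q 1 - q' 1| + 2 * |q 2 - q' 2| + 4 * |q 3 - q' 3| + |q 4 - q' 4| + 2 * |q 5 - q' 5|) := by
  have h := abs_emeryPressure_sub_le_emeryConstants β (emeryLine s q) (emeryLine s q')
  rw [sum_emeryConstants_mul_abs_emeryLine_sub] at h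
  have hβ := abs_nonneg β
  have h1 : |β| * (2 * (|s 0| + |s 1| + |s 2| + |s 3|) * |q 1 - q' 1|) ≤ |β| * (8 * |q 1 - q' 1|) := by
    refine mul_le_mul_of_nonneg_left ?_ hβ
    have := abs_nonneg (q 1 - q' 1)
    nlinarith [hs 0, hs 1, hs 2, hs 3]
  have hcell : emeryCellPressure β (emeryLine s q) - emeryCellPressure β (emeryLine s q') =
      4 * (emeryPressure β (emeryLine s q) - emeryPressure β (emeryLine s q')) := by
    rw [emeryCellPressure, emeryCellPressure]; ring
  rw [hcell, abs_mul, abs_of_pos (by norm_num : (0 : ℝ) < 4)]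
  nlinarith [h, h1, abs_nonneg (q 0 - q' 0), abs_nonneg (q 2 - q' 2), abs_nonneg (q 3 - q' 3), abs_nonneg (q 4 - q' 4), abs_nonneg (q 5 - q' 5)]

/-! ## §2 The cap door: four lower-face corner caps bind the box -/

/-- **Corner caps bind the six-box.** For `β ≥ 0`: `P_cell(β, emeryLine s (lowerCorner lo hi i)) ≤ M` for `i : Fin 4` ⇒ `P_cell ≤ M` on all of
`Set.Icc lo hi` (anti-monotonicity pushes any point to its lower-face projection; convexity bounds the lower face by its four vertices).
[cite: Israel1979, Thm. I.3.4] [cite: Rockafellar1970, Thm 32.2] -/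
theorem emeryCellPressure_line_le_of_lowerCorners {β : ℝ} (hβ : 0 ≤ β) (s : Fin 4 → ℝ) (lo hi : Fin 6 → ℝ) {M : ℝ}
    (hM : ∀ i : Fin 4, emeryCellPressure β (emeryLine s (lowerCorner lo hi i)) ≤ M) {q : Fin 6 → ℝ} (hq : q ∈ Set.Icc lo hi) :
    emeryCellPressure β (emeryLine s q) ≤ M := by
  have h1 : emeryCellPressure β (emeryLine s q) ≤ emeryCellPressure β (emeryLine s (lowerProj lo q)) :=
    emeryCellPressure_line_anti_tail hβ s (lowerProj_le hq) (by simp [lowerProj]) (by simp [lowerProj])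
  refine h1.trans ?_
  exact le_of_convexOn_of_forall_boxVertices (convexOn_emeryCellPressure_line β s) lo (lowerFace lo hi) (M := M)
    (forall_mem_piFinset_lowerFace (P := fun v => emeryCellPressure β (emeryLine s v) ≤ M) hM) (lowerProj_mem hq)

/-- **THE CAP DOOR on a typed Emery box.** For `β ≥ 0`, four corner caps at `lowerCorner (emeryLo εp …) (emeryHi εp …) i` give the box word
`p ↦ emeryCellPressure β (emeryLine s (emeryLineCoords εp p)) ≤ M`. (A corner cap is what `emeryCellPressure_le_log_partitionFn_boost` turns an upper bound on a
boosted `Cu_{k²}O_{2k²}` log-partition function into.) [cite: Israel1979, Thm. I.3.4] -/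
theorem holdsOn_emeryCellPressureCap_of_cornerCaps {E : EmeryBox} {eA eB eD eUd eUp : Entry} {εp : ℚ}
    (hA : E .tpd = some eA) (hB : E .tpp = some eB) (hD : E .DeltaPd = some eD)
    (hUd : E .Udd = some eUd) (hUp : E .Upp = some eUp) (s : Fin 4 → ℝ) {β : ℝ} (hβ : 0 ≤ β) {M : ℝ}
    (hM : ∀ i : Fin 4, emeryCellPressure β (emeryLine s (lowerCorner (emeryLo εp eA eB eD eUd eUp) (emeryHi εp eA eB eD eUd eUp) i)) ≤ M) :
    HoldsOn (fun p : EmeryCoord → ℝ => emeryCellPressure β (emeryLine s (emeryLineCoords (εp : ℝ) p)) ≤ M) E :=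
  fun _ hp => emeryCellPressure_line_le_of_lowerCorners hβ s _ _ hM (emeryLineCoords_mem_Icc hA hB hD hUd hUp hp)

/-! ## §3 The floor door in closed form: cluster Rayleigh traces -/

/-- `(Σ_a M_a) *ᵥ v = Σ_a (M_a *ᵥ v)`. [folklore] -/
theorem sum_mulVec_apply {ι m n : Type*} [Fintype n] (S : Finset ι) (M : ι → Matrix m n ℂ) (v : n → ℂ) :
    (∑ a ∈ S, M a) *ᵥ v = ∑ a ∈ S, M a *ᵥ v := by
  classical
  induction S using Finset.induction_on with
  | empty => simp
  | insert a S ha ih => rw [Finset.sum_insert ha, Finset.sum_insert ha, Matrix.add_mulVec, ih]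

/-- **The block Hamiltonian at `θ` is the `θ`-combination of the fourteen atom clusters**:
`hubbardOpenBoxGP 1 12 (blockTau θ) (blockUps θ) (blockNu θ) = Σ_a θ_a • hubbardOpenBoxGP 1 12 (cu4o8Tau a) (cu4o8Ups a) (cu4o8Nu a)`. [cite: PavariniEtAl2001, eq. (1)] -/
theorem hubbardOpenBoxGP_block_eq_sum (θ : Fin 14 → ℝ) :
    hubbardOpenBoxGP 1 12 (blockTau θ) (blockUps θ) (blockNu θ) =
      ∑ a, ((θ a : ℝ) : ℂ) • hubbardOpenBoxGP 1 12 (cu4o8Tau a) (cu4o8Ups a) (cu4o8Nu a) := by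
  rw [← relabel_block_emeryInteraction, InfVolFermionState.localHamiltonian_emeryInteraction, map_sum]
  simp_rw [map_smul, relabel_block_emeryAtoms]

/-- **A Rayleigh quotient is LINEAR in `θ`**: `Re⟨φ, H^G_θ φ⟩ = Σ_a θ_a · Re⟨φ, H^G_a φ⟩` with `H^G_a = hubbardOpenBoxGP 1 12 (cu4o8Tau a) (cu4o8Ups a) (cu4o8Nu a)`.
[cite: PavariniEtAl2001, eq. (1)] -/
theorem rayleigh_block_re_eq_sum (θ : Fin 14 → ℝ) (φ : Fock (Orb (Fin 1 ×ₗ Fin 12))) :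
    (star φ ⬝ᵥ (hubbardOpenBoxGP 1 12 (blockTau θ) (blockUps θ) (blockNu θ) *ᵥ φ)).re =
      ∑ a, θ a * (star φ ⬝ᵥ (hubbardOpenBoxGP 1 12 (cu4o8Tau a) (cu4o8Ups a) (cu4o8Nu a) *ᵥ φ)).re := by
  rw [hubbardOpenBoxGP_block_eq_sum, sum_mulVec_apply]
  simp_rw [Matrix.smul_mulVec, dotProduct_sum, dotProduct_smul, Complex.re_sum, smul_eq_mul, Complex.re_ofReal_mul]

/-- **Along the line, a vector's Rayleigh quotient is below the closed-form bound of its trace vector**: with exact per-atom traces `T a`,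
`Re⟨φ, H^G_{emeryLine s q} φ⟩ ≤ affineCapBound s T lo hi` on `Set.Icc lo hi`. [cite: PavariniEtAl2001, eq. (1)] -/
theorem rayleigh_block_line_le_affineCapBound (s : Fin 4 → ℝ) {φ : Fock (Orb (Fin 1 ×ₗ Fin 12))} {T : Fin 14 → ℝ}
    (hT : ∀ a, (star φ ⬝ᵥ (hubbardOpenBoxGP 1 12 (cu4o8Tau a) (cu4o8Ups a) (cu4o8Nu a) *ᵥ φ)).re = T a)
    {lo hi q : Fin 6 → ℝ} (hq : q ∈ Set.Icc lo hi) :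
    (star φ ⬝ᵥ (hubbardOpenBoxGP 1 12 (blockTau (emeryLine s q)) (blockUps (emeryLine s q)) (blockNu (emeryLine s q)) *ᵥ φ)).re ≤
      affineCapBound s T lo hi := by
  rw [rayleigh_block_re_eq_sum]
  simp_rw [hT]
  rw [sum_emeryLine_mul_eq]
  exact sum_mul_lineCoeff_le_affineCapBound s T hq

/-- **Floor on the six-box from Rayleigh traces** (`β ≥ 0`): an orthonormal family of `Cu₄O₈` cluster vectors with exact per-atom traces `T i a` gives
`¼ log Σᵢ exp(−β · affineCapBound s (T i) lo hi) ≤ P_cell(β, emeryLine s q)` for every `q ∈ Set.Icc lo hi`. [cite: Ruelle1969, §2.5–2.6] [cite: Israel1979, Lemma II.3.1] -/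
theorem le_emeryCellPressure_line_of_rayleighTraces {β : ℝ} (hβ : 0 ≤ β) (s : Fin 4 → ℝ) {ι : Type*} [Fintype ι] [DecidableEq ι] [Nonempty ι]
    {φ : ι → Fock (Orb (Fin 1 ×ₗ Fin 12))} (hφ : ∀ i j, star (φ i) ⬝ᵥ φ j = if i = j then 1 else 0)
    {T : ι → Fin 14 → ℝ} (hT : ∀ i a, (star (φ i) ⬝ᵥ (hubbardOpenBoxGP 1 12 (cu4o8Tau a) (cu4o8Ups a) (cu4o8Nu a) *ᵥ φ i)).re = T i a)
    (lo hi : Fin 6 → ℝ) {q : Fin 6 → ℝ} (hq : q ∈ Set.Icc lo hi) :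
    Real.log (∑ i, Real.exp (-(β * affineCapBound s (T i) lo hi))) / 4 ≤ emeryCellPressure β (emeryLine s q) :=
  le_emeryCellPressure_of_rayleighFamily hβ (emeryLine s q) hφ (e := fun i => affineCapBound s (T i) lo hi)
    fun i => rayleigh_block_line_le_affineCapBound s (hT i) hq

/-- **THE FLOOR DOOR on a typed Emery box, closed form.** For `β ≥ 0`, an orthonormal family `φᵢ` of `Cu₄O₈` cluster vectors (by rank, `Fin 1 ×ₗ Fin 12`)
with EXACT per-atom traces `T i a = Re⟨φᵢ, hubbardOpenBoxGP 1 12 (cu4o8Tau a) (cu4o8Ups a) (cu4o8Nu a) φᵢ⟩` gives the box word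
`p ↦ ¼ log Σᵢ exp(−β · affineCapBound s (T i) (emeryLo εp …) (emeryHi εp …)) ≤ emeryCellPressure β (emeryLine s (emeryLineCoords εp p))` — no vertex
enumeration, nothing else assumed. [cite: Ruelle1969, §2.5–2.6] [cite: Israel1979, Lemma II.3.1] -/
theorem holdsOn_emeryCellPressureFloor_of_rayleighTraces {E : EmeryBox} {eA eB eD eUd eUp : Entry} {εp : ℚ}
    (hA : E .tpd = some eA) (hB : E .tpp = some eB) (hD : E .DeltaPd = some eD)
    (hUd : E .Udd = some eUd) (hUp : E .Upp = some eUp) (s : Fin 4 → ℝ) {β : ℝ} (hβ : 0 ≤ β)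
    {ι : Type*} [Fintype ι] [DecidableEq ι] [Nonempty ι]
    {φ : ι → Fock (Orb (Fin 1 ×ₗ Fin 12))} (hφ : ∀ i j, star (φ i) ⬝ᵥ φ j = if i = j then 1 else 0)
    {T : ι → Fin 14 → ℝ} (hT : ∀ i a, (star (φ i) ⬝ᵥ (hubbardOpenBoxGP 1 12 (cu4o8Tau a) (cu4o8Ups a) (cu4o8Nu a) *ᵥ φ i)).re = T i a) :
    HoldsOn (fun p : EmeryCoord → ℝ =>
      Real.log (∑ i, Real.exp (-(β * affineCapBound s (T i) (emeryLo εp eA eB eD eUd eUp) (emeryHi εp eA eB eD eUd eUp)))) / 4 ≤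
        emeryCellPressure β (emeryLine s (emeryLineCoords (εp : ℝ) p))) E :=
  fun _ hp => le_emeryCellPressure_line_of_rayleighTraces hβ s hφ hT _ _ (emeryLineCoords_mem_Icc hA hB hD hUd hUp hp)

/-! ## §4 Transport across the box -/

/-- **THE PRESSURE PRICE OF THE 3BE BOX WIDTH**: two parameter vectors of one Emery box (unit sign pattern, common reference level) have cell pressures
within `4|β|·(8·w(t_pd) + 8·w(t_pp) + 2·w(Delta_pd) + w(U_dd) + 2·w(U_pp))` of each other. [cite: Israel1979, Thm. I.3.4] -/
theorem abs_emeryCellPressure_sub_le_of_mem_emeryLineBox {E : EmeryBox} {eA eB eD eUd eUp : Entry}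
    (hA : E .tpd = some eA) (hB : E .tpp = some eB) (hD : E .DeltaPd = some eD)
    (hUd : E .Udd = some eUd) (hUp : E .Upp = some eUp) (β : ℝ) {s : Fin 4 → ℝ} (hs : ∀ k, |s k| ≤ 1) (εp : ℝ)
    {p p' : EmeryCoord → ℝ} (hp : E.Mem p) (hp' : E.Mem p') :
    |emeryCellPressure β (emeryLine s (emeryLineCoords εp p)) - emeryCellPressure β (emeryLine s (emeryLineCoords εp p'))| ≤
      4 * |β| * (8 * eA.widthR + 8 * eB.widthR + 2 * eD.widthR + eUd.widthR + 2 * eUp.widthR) := by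
  have h := abs_emeryCellPressure_line_sub_le β hs (emeryLineCoords εp p) (emeryLineCoords εp p')
  have h0 := Entry.abs_sub_le_widthR (hp _ _ hA) (hp' _ _ hA)
  have h1 := Entry.abs_sub_le_widthR (hp _ _ hB) (hp' _ _ hB)
  have h2 := Entry.abs_sub_le_widthR (hp _ _ hD) (hp' _ _ hD)
  have h4 := Entry.abs_sub_le_widthR (hp _ _ hUd) (hp' _ _ hUd)
  have h5 := Entry.abs_sub_le_widthR (hp _ _ hUp) (hp' _ _ hUp)
  have e0 : emeryLineCoords εp p 0 - emeryLineCoords εp p' 0 = p .tpd - p' .tpd := by simp [emeryLineCoords]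
  have e1 : emeryLineCoords εp p 1 - emeryLineCoords εp p' 1 = p .tpp - p' .tpp := by simp [emeryLineCoords]
  have e2 : emeryLineCoords εp p 2 - emeryLineCoords εp p' 2 = p .DeltaPd - p' .DeltaPd := by simp [emeryLineCoords]
  have e3 : emeryLineCoords εp p 3 - emeryLineCoords εp p' 3 = 0 := by simp [emeryLineCoords]
  have e4 : emeryLineCoords εp p 4 - emeryLineCoords εp p' 4 = p .Udd - p' .Udd := by simp [emeryLineCoords]
  have e5 : emeryLineCoords εp p 5 - emeryLineCoords εp p' 5 = p .Upp - p' .Upp := by simp [emeryLineCoords]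
  rw [e0, e1, e2, e3, e4, e5, abs_zero] at h
  have hβ := abs_nonneg β
  nlinarith [h, h0, h1, h2, h4, h5, mul_nonneg hβ (abs_nonneg (p .tpd - p' .tpd)), mul_nonneg hβ (abs_nonneg (p .tpp - p' .tpp)),
    mul_nonneg hβ (abs_nonneg (p .DeltaPd - p' .DeltaPd)), mul_nonneg hβ (abs_nonneg (p .Udd - p' .Udd)), mul_nonneg hβ (abs_nonneg (p .Upp - p' .Upp))]

/-- **One certified point ⇒ a box FLOOR word**: `L ≤ P_cell` at some `p₀ ∈ E` gives `L − 4|β|·budget ≤ P_cell` on all of `E`. [cite: Israel1979, Thm. I.3.4] -/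
theorem holdsOn_emeryCellPressureFloor_of_point {E : EmeryBox} {eA eB eD eUd eUp : Entry}
    (hA : E .tpd = some eA) (hB : E .tpp = some eB) (hD : E .DeltaPd = some eD)
    (hUd : E .Udd = some eUd) (hUp : E .Upp = some eUp) (β : ℝ) {s : Fin 4 → ℝ} (hs : ∀ k, |s k| ≤ 1) (εp : ℝ)
    {p₀ : EmeryCoord → ℝ} (hp₀ : E.Mem p₀) {L : ℝ} (hL : L ≤ emeryCellPressure β (emeryLine s (emeryLineCoords εp p₀))) :
    HoldsOn (fun p : EmeryCoord → ℝ =>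
      L - 4 * |β| * (8 * eA.widthR + 8 * eB.widthR + 2 * eD.widthR + eUd.widthR + 2 * eUp.widthR) ≤
        emeryCellPressure β (emeryLine s (emeryLineCoords εp p))) E := by
  intro p hp
  have h := abs_emeryCellPressure_sub_le_of_mem_emeryLineBox hA hB hD hUd hUp β hs εp hp₀ hp
  rw [abs_le] at h
  linarith [h.2]

/-- **One certified point ⇒ a box CAP word**: `P_cell ≤ U` at some `p₀ ∈ E` gives `P_cell ≤ U + 4|β|·budget` on all of `E`. [cite: Israel1979, Thm. I.3.4] -/
theorem holdsOn_emeryCellPressureCap_of_point {E : EmeryBox} {eA eB eD eUd eUp : Entry}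
    (hA : E .tpd = some eA) (hB : E .tpp = some eB) (hD : E .DeltaPd = some eD)
    (hUd : E .Udd = some eUd) (hUp : E .Upp = some eUp) (β : ℝ) {s : Fin 4 → ℝ} (hs : ∀ k, |s k| ≤ 1) (εp : ℝ)
    {p₀ : EmeryCoord → ℝ} (hp₀ : E.Mem p₀) {U : ℝ} (hU : emeryCellPressure β (emeryLine s (emeryLineCoords εp p₀)) ≤ U) :
    HoldsOn (fun p : EmeryCoord → ℝ =>
      emeryCellPressure β (emeryLine s (emeryLineCoords εp p)) ≤
        U + 4 * |β| * (8 * eA.widthR + 8 * eB.widthR + 2 * eD.widthR + eUd.widthR + 2 * eUp.widthR)) E := by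
  intro p hp
  have h := abs_emeryCellPressure_sub_le_of_mem_emeryLineBox hA hB hD hUd hUp β hs εp hp₀ hp
  rw [abs_le] at h
  linarith [h.1]

/-! ## §5 La₂CuO₄ (#18): the thermal order sheet on `emeryBoxLa214v123` -/

/-- **The La₂CuO₄ thermal corner sheet at reference level `εp`** (order `(t_pd, t_pp, ε_d, ε_p, U_d, U_p)`, eV): the four lower-face corners of the v1.23
companion's delivered six-box, `(129/100 | 38/25, 23/50 | 33/50, 17/10 + εp, εp, 483/100, 339/100)`; `−εp` is the chemical potential. [folklore] -/
def la214v123Corner (εp : ℚ) : Fin 4 → Fin 6 → ℝ :=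
  lowerCorner (emeryLo εp la214Emery_tpd la214Emery_tpp la214Emery_Delta la214Emery_Udd_v122 la214Emery_Upp_exact)
    (emeryHi εp la214Emery_tpd la214Emery_tpp la214Emery_Delta la214Emery_Udd_v122 la214Emery_Upp_exact)

/-- At `εp = 0` the thermal corner sheet IS the robust energy order sheet `la214v122xCorner`. [folklore] -/
theorem la214v123Corner_zero : la214v123Corner 0 = la214v122xCorner := la214v122x_lowerCorner

/-- The thermal corners explicitly: `(t_pd, t_pp) ∈ {1.29, 1.52} × {0.46, 0.66}`, tail `(17/10 + εp, εp, 483/100, 339/100)`. [folklore] -/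
theorem la214v123Corner_eq (εp : ℚ) :
    la214v123Corner εp = ![![129/100, 23/50, 17/10 + (εp : ℝ), (εp : ℝ), 483/100, 339/100], ![38/25, 23/50, 17/10 + (εp : ℝ), (εp : ℝ), 483/100, 339/100],
      ![129/100, 33/50, 17/10 + (εp : ℝ), (εp : ℝ), 483/100, 339/100], ![38/25, 33/50, 17/10 + (εp : ℝ), (εp : ℝ), 483/100, 339/100]] := by
  ext i k
  fin_cases i <;> fin_cases k <;>
    simp [la214v123Corner, lowerCorner, emeryLo, emeryHi, la214Emery_tpd, la214Emery_tpp, la214Emery_Delta, la214Emery_Udd_v122, la214Emery_Upp_exact] <;>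
    ring

/-- **La₂CuO₄ CAP DOOR**: four corner caps of the cell pressure at `la214v123Corner εp i` (`β ≥ 0`) ⇒ the cap word on `emeryBoxLa214v123`.
[cite: Israel1979, Thm. I.3.4] -/
theorem emeryBoxLa214v123_pressureCap_of_cornerCaps (εp : ℚ) (s : Fin 4 → ℝ) {β : ℝ} (hβ : 0 ≤ β) {M : ℝ}
    (hM : ∀ i : Fin 4, emeryCellPressure β (emeryLine s (la214v123Corner εp i)) ≤ M) :
    HoldsOn (fun p : EmeryCoord → ℝ => emeryCellPressure β (emeryLine s (emeryLineCoords (εp : ℝ) p)) ≤ M) emeryBoxLa214v123 :=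
  holdsOn_emeryCellPressureCap_of_cornerCaps (E := emeryBoxLa214v123) emeryBoxLa214v123_entries.1 emeryBoxLa214v123_entries.2.1
    emeryBoxLa214v123_entries.2.2.1 emeryBoxLa214v123_entries.2.2.2.1 emeryBoxLa214v123_entries.2.2.2.2.1 s hβ hM

/-- **La₂CuO₄ FLOOR DOOR (closed form)**: an orthonormal family of `Cu₄O₈` cluster vectors with exact per-atom traces ⇒ the floor word
`¼ log Σᵢ exp(−β · affineCapBound s (T i) lo hi) ≤ P_cell` on `emeryBoxLa214v123` (`lo/hi` = its delivered six-box at `εp`). [cite: Ruelle1969, §2.5–2.6] -/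
theorem emeryBoxLa214v123_pressureFloor_of_rayleighTraces (εp : ℚ) (s : Fin 4 → ℝ) {β : ℝ} (hβ : 0 ≤ β)
    {ι : Type*} [Fintype ι] [DecidableEq ι] [Nonempty ι]
    {φ : ι → Fock (Orb (Fin 1 ×ₗ Fin 12))} (hφ : ∀ i j, star (φ i) ⬝ᵥ φ j = if i = j then 1 else 0)
    {T : ι → Fin 14 → ℝ} (hT : ∀ i a, (star (φ i) ⬝ᵥ (hubbardOpenBoxGP 1 12 (cu4o8Tau a) (cu4o8Ups a) (cu4o8Nu a) *ᵥ φ i)).re = T i a) :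
    HoldsOn (fun p : EmeryCoord → ℝ =>
      Real.log (∑ i, Real.exp (-(β * affineCapBound s (T i)
        (emeryLo εp la214Emery_tpd la214Emery_tpp la214Emery_Delta la214Emery_Udd_v122 la214Emery_Upp_exact)
        (emeryHi εp la214Emery_tpd la214Emery_tpp la214Emery_Delta la214Emery_Udd_v122 la214Emery_Upp_exact)))) / 4 ≤
        emeryCellPressure β (emeryLine s (emeryLineCoords (εp : ℝ) p))) emeryBoxLa214v123 :=
  holdsOn_emeryCellPressureFloor_of_rayleighTraces (E := emeryBoxLa214v123) emeryBoxLa214v123_entries.1 emeryBoxLa214v123_entries.2.1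
    emeryBoxLa214v123_entries.2.2.1 emeryBoxLa214v123_entries.2.2.2.1 emeryBoxLa214v123_entries.2.2.2.2.1 s hβ hφ hT

/-- **La₂CuO₄ thermal transport budget**: `4·(8·0.23 + 8·0.2 + 2·2.3 + 5.67 + 2·2.74) = 4·19.19 = 76.76` eV per unit `|β|` — two points of the v1.23 companion
have cell pressures within `76.76·|β|` (cuprate sign pattern, common `εp`). [cite: Israel1979, Thm. I.3.4] -/
theorem emeryBoxLa214v123_pressure_transport (β εp : ℝ) {p p' : EmeryCoord → ℝ} (hp : emeryBoxLa214v123.Mem p) (hp' : emeryBoxLa214v123.Mem p') :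
    |emeryCellPressure β (emeryLine cuprateSigns (emeryLineCoords εp p)) - emeryCellPressure β (emeryLine cuprateSigns (emeryLineCoords εp p'))| ≤
      (7676 / 100 : ℝ) * |β| := by
  have h := abs_emeryCellPressure_sub_le_of_mem_emeryLineBox (E := emeryBoxLa214v123) emeryBoxLa214v123_entries.1 emeryBoxLa214v123_entries.2.1
    emeryBoxLa214v123_entries.2.2.1 emeryBoxLa214v123_entries.2.2.2.1 emeryBoxLa214v123_entries.2.2.2.2.1 β abs_cuprateSigns_le_one εp hp hp'
  have hw : 8 * la214Emery_tpd.widthR + 8 * la214Emery_tpp.widthR + 2 * la214Emery_Delta.widthR + la214Emery_Udd_v122.widthR +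
      2 * la214Emery_Upp_exact.widthR = ((1919/100 : ℚ) : ℝ) := la214v123_widthBudget
  rw [hw] at h
  have : (4 : ℝ) * |β| * (((1919/100 : ℚ) : ℝ)) = 7676 / 100 * |β| := by push_cast; ring
  linarith

end Summit.Ventures.CertifiedManyBodySolver.Downfold

end
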